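import Summits.QuantumFields.YangMills.Theorems.BalabanLadderIRTwistedSlabBoxPurity
import Summits.QuantumFields.YangMills.Theorems.BalabanLadderIRTwistedSlabLongTimeDuality
import HarnessLib

/-!
# The purity defect of the projected twisted slab is WORST AT SHORT TIMES: `t ↦ projSlabDefect(β; ℓ, L, t)` is non-increasing
# on `t ≥ 2`; doubling sub-multiplicativity of `projSlabZ` in BOTH long directions; the transfer matrix ALONG the tube

HELPER toward stub **T1** `TwistedSlabAnchor` of LINE `twisted-slab-continuity` (crux `IRcof`, stmt-QuantumFields-26930, census row 43;
LEAD prover ym-ir-line-tsc-p1 g6; `--supports` the crux, `--as helper`).  Theorems only.  K40 of the T1 programme — STRUCTURE of the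
line's central quantity, for every compact `G`, every continuous unitary `ρ`, every central `z` with `z ^ n = 1`, every `β ≥ 0` and every box:

* §1 (pure real analysis, namespace `SpectralPurity`, the currency of K34∕K37: `μᵢ ≥ 0`, `Σᵢ μᵢ^t = Z(t)` for `t ≥ t₀`):
  `sum_mul_sum_le_of_comonotone` (Chebyshev's sum inequality with non-negative weights), `powSum_succ_sq_le`
  (`Z(t+1)² ≤ Z(t)·Z(t+2)`, Cauchy–Schwarz), `powSum_chebyshev` (`Z(t+2)·Z(2t) ≤ Z(2t+2)·Z(t)`), ★ `powSum_ratio_mono`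
  (`Z(2t)∕Z(t)² ≤ Z(2t+2)∕Z(t+1)²`: the map `t ↦ Z(2t)∕Z(t)²` — the purity `Tr ϱ_t²` of the normalised state `ϱ_t ∝ 𝕋^t` — is
  NON-DECREASING), `powSum_two_mul_le_sq` (`Z(2t) ≤ Z(t)²`);
* §2 (the lattice, via K35 `exists_spectralData_projSlabZ`): ★★ `projSlabDefect_antitone` — `2 ≤ t ≤ t' ⇒ projSlabDefect(t') ≤ projSlabDefect(t)`:
  the period-doubling purity defect of 't Hooft's e₂-projected twisted slab DECREASES along Euclidean time, so it is largest at `t = 2`; hence the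
  THRESHOLD-FREE one-time lever ★ `projSlabDefect_le_of_le_at` (`projSlabDefect(t*) ≤ δ ⇒ projSlabDefect(t) ≤ δ` for all `t ≥ t* ≥ 2`, ANY `δ` —
  K35's `projSlabDefect_le_two_mul_pow_of_le` needs `δ < 1∕2` but gives a rate); `projSlabDefect_nonneg'` ∕ `projSlabZ_two_mul_le_sq` (`t ≥ 2`);
* §3 (the LONG direction, via g2's exchange identity `projSlabZ_swap` + K35 at `z⁻¹`): ★ `exists_spectralData_projSlabZ_long` — for every time
  period `t` (even `t = 1`) the map `L ↦ projSlabZ(β; ℓ, L, t)` is a power sum `Σ_j μ_j(t)^L` (`L ≥ 2`), `μ_j ≥ 0` WITH multiplicity: the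
  eigenvalues of 't Hooft's e-projected transfer matrix ALONG the tube (direction `2`; slice = twisted `ℓ × ℓ` torus × time circle); hence
  `projSlabZ_two_mul_long_le_sq` (`projSlabZ(2L) ≤ projSlabZ(L)²`, `L ≥ 2`) and ★ `lengthDefect_antitone` (the LENGTH-doubling defect
  `1 − projSlabZ(2L)∕projSlabZ(L)²` is non-increasing in `L ≥ 2` at every fixed `t`).

WHY (for T1): T1 asks `projSlabDefect ≤ C·L·e^{−ct}` for ALL `t ≥ 1`; by §2 an upper bound at one time is an upper bound at all later times, so
every T1-type estimate is decided at ONE time per scale (the rate then comes from K37's second time or from the bound's own `t`-dependence), and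
the trivial bound `≤ 1` is only ever needed below the first controlled time.  HONEST FRAMING: identities and monotonicity; no estimate uniform
in `L`; T1 (M4: the transposition `∀L∃β₀ → ∃β₀∀L`, an `L`-uniform weak-coupling cluster expansion) 0∕1, not claimed; nothing here bears on
`IRcof`, `IR`, or the Yang–Mills mass gap (Clay: NOT proved); R4 = `BalabanLadder.UV` only.

References: G. 't Hooft, Nucl. Phys. B 153 (1979) 141, §5 (5.1)–(5.4), §6 (6.2); G. H. Hardy, J. E. Littlewood, G. Pólya, *Inequalities*
(1952) §2.17 Thm 43 (Chebyshev); B. Simon, *The Statistical Mechanics of Lattice Gases* I (1993) §II.13.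
-/

set_option autoImplicit false

noncomputable section

open Filter Topology Finset
open scoped BigOperators
open Literature.MathematicalPhysics.QuantumFieldTheory

namespace Summit.QuantumFields.YangMills.Cruxes.IRcof.TwistedSlab

/-! ## §1 Power sums of a non-negative family: Chebyshev, Cauchy–Schwarz, monotone purity -/

namespace SpectralPurity

variable {ι : Type*} {μ : ι → ℝ} {Z : ℕ → ℝ} {t₀ : ℕ}

/-- **Chebyshev's sum inequality with non-negative weights**: if `a ≥ 0` and `f, g` are comonotone
(`(fᵢ − fⱼ)(gᵢ − gⱼ) ≥ 0`), then `(Σ a f)(Σ a g) ≤ (Σ a f g)(Σ a)` — twice the difference is `Σᵢ Σⱼ aᵢ aⱼ (fᵢ − fⱼ)(gᵢ − gⱼ) ≥ 0`.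
[cite: HardyLittlewoodPolya1952, §2.17 Thm 43] -/
theorem sum_mul_sum_le_of_comonotone (s : Finset ι) (a f g : ι → ℝ) (ha : ∀ i, 0 ≤ a i)
    (hfg : ∀ i j, 0 ≤ (f i - f j) * (g i - g j)) :
    (∑ i ∈ s, a i * f i) * (∑ i ∈ s, a i * g i) ≤ (∑ i ∈ s, a i * (f i * g i)) * ∑ i ∈ s, a i := by
  have hexp : ∀ i j, a i * a j * ((f i - f j) * (g i - g j)) =
      a i * (f i * g i) * a j - a i * f i * (a j * g j) - a i * g i * (a j * f j) + a i * (a j * (f j * g j)) :=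
    fun i j => by ring
  have h1 : (∑ i ∈ s, a i * (f i * g i)) * (∑ j ∈ s, a j) = ∑ i ∈ s, ∑ j ∈ s, a i * (f i * g i) * a j :=
    Finset.sum_mul_sum _ _ _ _
  have h2 : (∑ i ∈ s, a i * f i) * (∑ j ∈ s, a j * g j) = ∑ i ∈ s, ∑ j ∈ s, a i * f i * (a j * g j) :=
    Finset.sum_mul_sum _ _ _ _
  have h3 : (∑ i ∈ s, a i * g i) * (∑ j ∈ s, a j * f j) = ∑ i ∈ s, ∑ j ∈ s, a i * g i * (a j * f j) :=
    Finset.sum_mul_sum _ _ _ _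
  have h4 : (∑ i ∈ s, a i) * (∑ j ∈ s, a j * (f j * g j)) = ∑ i ∈ s, ∑ j ∈ s, a i * (a j * (f j * g j)) :=
    Finset.sum_mul_sum _ _ _ _
  have hnn : 0 ≤ ∑ i ∈ s, ∑ j ∈ s, a i * a j * ((f i - f j) * (g i - g j)) :=
    Finset.sum_nonneg fun i _ => Finset.sum_nonneg fun j _ => mul_nonneg (mul_nonneg (ha i) (ha j)) (hfg i j)
  have hid : ∑ i ∈ s, ∑ j ∈ s, a i * a j * ((f i - f j) * (g i - g j)) =
      (∑ i ∈ s, ∑ j ∈ s, a i * (f i * g i) * a j) - (∑ i ∈ s, ∑ j ∈ s, a i * f i * (a j * g j)) -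
        (∑ i ∈ s, ∑ j ∈ s, a i * g i * (a j * f j)) + ∑ i ∈ s, ∑ j ∈ s, a i * (a j * (f j * g j)) := by
    simp only [hexp, Finset.sum_add_distrib, Finset.sum_sub_distrib]
  have hc : (∑ i ∈ s, a i * g i) * (∑ j ∈ s, a j * f j) = (∑ i ∈ s, a i * f i) * (∑ j ∈ s, a j * g j) := mul_comm _ _
  have hc' : (∑ i ∈ s, a i) * (∑ j ∈ s, a j * (f j * g j)) = (∑ i ∈ s, a i * (f i * g i)) * (∑ j ∈ s, a j) := mul_comm _ _
  linarith

/-- For `x, y ≥ 0` the powers `x ↦ x^p`, `x ↦ x^q` are comonotone: `(x^p − y^p)(x^q − y^q) ≥ 0`. [folklore] -/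
theorem pow_sub_pow_mul_pow_sub_pow_nonneg {x y : ℝ} (hx : 0 ≤ x) (hy : 0 ≤ y) (p q : ℕ) :
    0 ≤ (x ^ p - y ^ p) * (x ^ q - y ^ q) := by
  rcases le_total x y with h | h
  · exact mul_nonneg_of_nonpos_of_nonpos (sub_nonpos.2 (pow_le_pow_left₀ hx h p)) (sub_nonpos.2 (pow_le_pow_left₀ hx h q))
  · exact mul_nonneg (sub_nonneg.2 (pow_le_pow_left₀ hy h p)) (sub_nonneg.2 (pow_le_pow_left₀ hy h q))

/-- The finite Chebyshev inequality for power sums: `(Σ_F μ^{t+p})(Σ_F μ^{t+q}) ≤ (Σ_F μ^{t+p+q})(Σ_F μ^t)` (weights `μ^t`). [folklore] -/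
theorem sum_pow_mul_sum_pow_le (hμ : ∀ i, 0 ≤ μ i) (F : Finset ι) (t p q : ℕ) :
    (∑ i ∈ F, μ i ^ (t + p)) * (∑ i ∈ F, μ i ^ (t + q)) ≤ (∑ i ∈ F, μ i ^ (t + p + q)) * ∑ i ∈ F, μ i ^ t := by
  have h := sum_mul_sum_le_of_comonotone F (fun i => μ i ^ t) (fun i => μ i ^ p) (fun i => μ i ^ q)
    (fun i => pow_nonneg (hμ i) t) (fun i j => pow_sub_pow_mul_pow_sub_pow_nonneg (hμ i) (hμ j) p q)
  simp only [← pow_add] at h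
  rw [show t + p + q = t + (p + q) from add_assoc t p q]
  exact h

/-- The partial sums of `μ^t` converge to `Z(t)` (the `HasSum` hypothesis, as a `Tendsto`). [folklore] -/
theorem tendsto_sum_pow (hZ : ∀ t, t₀ ≤ t → HasSum (fun i => μ i ^ t) (Z t)) {t : ℕ} (ht : t₀ ≤ t) :
    Tendsto (fun F : Finset ι => ∑ i ∈ F, μ i ^ t) atTop (𝓝 (Z t)) :=
  hZ t ht

/-- Power sums of a non-negative family are non-negative. [folklore] -/
theorem powSum_nonneg (hμ : ∀ i, 0 ≤ μ i) (hZ : ∀ t, t₀ ≤ t → HasSum (fun i => μ i ^ t) (Z t)) {t : ℕ} (ht : t₀ ≤ t) :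
    0 ≤ Z t :=
  (hZ t ht).nonneg fun i => pow_nonneg (hμ i) t

/-- **Log-convexity step (Cauchy–Schwarz)**: `Z(t+1)² ≤ Z(t)·Z(t+2)` for `t ≥ t₀`. [folklore] -/
theorem powSum_succ_sq_le (hμ : ∀ i, 0 ≤ μ i) (hZ : ∀ t, t₀ ≤ t → HasSum (fun i => μ i ^ t) (Z t)) {t : ℕ}
    (ht : t₀ ≤ t) : Z (t + 1) ^ 2 ≤ Z t * Z (t + 2) := by
  have hfin : ∀ F : Finset ι, (∑ i ∈ F, μ i ^ (t + 1)) * (∑ i ∈ F, μ i ^ (t + 1)) ≤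
      (∑ i ∈ F, μ i ^ (t + 2)) * ∑ i ∈ F, μ i ^ t := fun F => by
    simpa using sum_pow_mul_sum_pow_le hμ F t 1 1
  have hl : Tendsto (fun F : Finset ι => (∑ i ∈ F, μ i ^ (t + 1)) * ∑ i ∈ F, μ i ^ (t + 1)) atTop
      (𝓝 (Z (t + 1) * Z (t + 1))) :=
    (tendsto_sum_pow hZ (by omega)).mul (tendsto_sum_pow hZ (by omega))
  have hr : Tendsto (fun F : Finset ι => (∑ i ∈ F, μ i ^ (t + 2)) * ∑ i ∈ F, μ i ^ t) atTop (𝓝 (Z (t + 2) * Z t)) :=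
    (tendsto_sum_pow hZ (by omega)).mul (tendsto_sum_pow hZ ht)
  have := le_of_tendsto_of_tendsto' hl hr hfin
  nlinarith [this]

/-- **Chebyshev step**: `Z(t+2)·Z(2t) ≤ Z(2t+2)·Z(t)` for `t ≥ t₀` (weights `μ^t`, comonotone `μ²`, `μ^t`). [folklore] -/
theorem powSum_chebyshev (hμ : ∀ i, 0 ≤ μ i) (hZ : ∀ t, t₀ ≤ t → HasSum (fun i => μ i ^ t) (Z t)) {t : ℕ}
    (ht : t₀ ≤ t) : Z (t + 2) * Z (2 * t) ≤ Z (2 * t + 2) * Z t := by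
  have e1 : t + t = 2 * t := by ring
  have e2 : t + 2 + t = 2 * t + 2 := by ring
  have hfin : ∀ F : Finset ι, (∑ i ∈ F, μ i ^ (t + 2)) * (∑ i ∈ F, μ i ^ (2 * t)) ≤
      (∑ i ∈ F, μ i ^ (2 * t + 2)) * ∑ i ∈ F, μ i ^ t := fun F => by
    have h := sum_pow_mul_sum_pow_le hμ F t 2 t
    rwa [e1, e2] at h
  have hl : Tendsto (fun F : Finset ι => (∑ i ∈ F, μ i ^ (t + 2)) * ∑ i ∈ F, μ i ^ (2 * t)) atTop
      (𝓝 (Z (t + 2) * Z (2 * t))) :=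
    (tendsto_sum_pow hZ (by omega)).mul (tendsto_sum_pow hZ (by omega))
  have hr : Tendsto (fun F : Finset ι => (∑ i ∈ F, μ i ^ (2 * t + 2)) * ∑ i ∈ F, μ i ^ t) atTop
      (𝓝 (Z (2 * t + 2) * Z t)) :=
    (tendsto_sum_pow hZ (by omega)).mul (tendsto_sum_pow hZ ht)
  exact le_of_tendsto_of_tendsto' hl hr hfin

/-- ★ **MONOTONE PURITY**: `Z(2t)·Z(t+1)² ≤ Z(2(t+1))·Z(t)²` for `t ≥ t₀`, i.e. the purity `Z(2t)∕Z(t)²` of the normalised state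
`ϱ_t ∝ 𝕋^t` does not decrease from `t` to `t+1` (Cauchy–Schwarz × Chebyshev; integer multiplicities are not needed here). [folklore] -/
theorem powSum_ratio_mono (hμ : ∀ i, 0 ≤ μ i) (hZ : ∀ t, t₀ ≤ t → HasSum (fun i => μ i ^ t) (Z t)) {t : ℕ}
    (ht : t₀ ≤ t) : Z (2 * t) * Z (t + 1) ^ 2 ≤ Z (2 * (t + 1)) * Z t ^ 2 := by
  have h1 := powSum_succ_sq_le hμ hZ ht
  have h2 := powSum_chebyshev hμ hZ ht
  have h0 : 0 ≤ Z (2 * t) := powSum_nonneg hμ hZ (by omega)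
  have h0' : 0 ≤ Z t := powSum_nonneg hμ hZ ht
  have e : 2 * (t + 1) = 2 * t + 2 := by ring
  rw [e]
  calc Z (2 * t) * Z (t + 1) ^ 2 ≤ Z (2 * t) * (Z t * Z (t + 2)) := mul_le_mul_of_nonneg_left h1 h0
    _ = (Z (t + 2) * Z (2 * t)) * Z t := by ring
    _ ≤ (Z (2 * t + 2) * Z t) * Z t := mul_le_mul_of_nonneg_right h2 h0'
    _ = Z (2 * t + 2) * Z t ^ 2 := by ring

/-- ★ The defect does not increase from `t` to `t+1` (`t ≥ t₀`, `Z(t), Z(t+1) > 0`). [folklore] -/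
theorem defect_succ_le (hμ : ∀ i, 0 ≤ μ i) (hZ : ∀ t, t₀ ≤ t → HasSum (fun i => μ i ^ t) (Z t)) {t : ℕ}
    (ht : t₀ ≤ t) (hpos : 0 < Z t) (hpos' : 0 < Z (t + 1)) :
    1 - Z (2 * (t + 1)) / Z (t + 1) ^ 2 ≤ 1 - Z (2 * t) / Z t ^ 2 := by
  have h := powSum_ratio_mono hμ hZ ht
  have hq : Z (2 * t) / Z t ^ 2 ≤ Z (2 * (t + 1)) / Z (t + 1) ^ 2 := by
    rw [div_le_div_iff₀ (by positivity) (by positivity)]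
    exact h
  linarith

/-- `Z(2t) ≤ Z(t)²` for `t ≥ t₀` (termwise `Σ (μ^t)² ≤ (Σ μ^t)²`), i.e. the defect `1 − Z(2t)∕Z(t)²` is non-negative. [folklore] -/
theorem powSum_two_mul_le_sq (hμ : ∀ i, 0 ≤ μ i) (hZ : ∀ t, t₀ ≤ t → HasSum (fun i => μ i ^ t) (Z t)) {t : ℕ}
    (ht : t₀ ≤ t) : Z (2 * t) ≤ Z t ^ 2 := by
  refine hasSum_le_of_sum_le (hZ (2 * t) (by omega)) fun F => ?_
  have hF : ∑ i ∈ F, μ i ^ t ≤ Z t := sum_le_hasSum F (fun i _ => pow_nonneg (hμ i) t) (hZ t ht)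
  have hF0 : 0 ≤ ∑ i ∈ F, μ i ^ t := Finset.sum_nonneg fun i _ => pow_nonneg (hμ i) t
  calc ∑ i ∈ F, μ i ^ (2 * t) = ∑ i ∈ F, (μ i ^ t) ^ 2 := Finset.sum_congr rfl fun i _ => by rw [← pow_mul, mul_comm]
    _ ≤ (∑ i ∈ F, μ i ^ t) ^ 2 := Finset.sum_sq_le_sq_sum_of_nonneg fun i _ => pow_nonneg (hμ i) t
    _ ≤ Z t ^ 2 := pow_le_pow_left₀ hF0 hF 2

end SpectralPurity

/-! ## §2 The lattice: the projected twisted purity defect is non-increasing in Euclidean time -/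

section Lattice

variable {G : Type*} [Group G] [TopologicalSpace G] [IsTopologicalGroup G] [CompactSpace G]
  [MeasurableSpace G] [BorelSpace G] [SecondCountableTopology G] {N : ℕ} {ρ : G →* Matrix (Fin N) (Fin N) ℂ}

/-- The spectral power sums of K35 in the currency of §1 (`t₀ = 2`). [cite: tHooft1979Flux, §5 (5.1)–(5.4)] -/
theorem exists_powSum_projSlabZ (hρ : Continuous ρ) (hρu : ∀ g, ρ g ∈ Matrix.unitaryGroup (Fin N) ℂ)
    {β : ℝ} (hβ : 0 ≤ β) {z : G} (hz : z ∈ Subgroup.center G) {m : ℕ} (hzn : z ^ (m + 1) = 1) (ℓ L : ℕ) :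
    ∃ (s : Set (MeasureTheory.Lp ℝ 2 (MeasureTheory.Measure.pi fun _ : FinSpatialSite ℓ ℓ L × Fin 3 => haarProbability G)))
      (ν : s → ℝ), (∀ j, 0 ≤ ν j) ∧ ∀ t, 2 ≤ t → HasSum (fun j => ν j ^ t) (projSlabZ ρ β z (m + 1) ℓ L t) := by
  obtain ⟨s, ν, hν, -, hsum⟩ := exists_spectralData_projSlabZ hρ hρu hβ hz hzn ℓ L
  refine ⟨s, ν, hν, fun t ht => ?_⟩
  obtain ⟨M, rfl⟩ : ∃ M, t = M + 2 := ⟨t - 2, by omega⟩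
  exact hsum M

/-- One step: `projSlabDefect(t+1) ≤ projSlabDefect(t)` for `t ≥ 2` (`β ≥ 0`, continuous unitary `ρ`, central `z`, `z ^ n = 1`, `n ≥ 1`,
any box). [cite: tHooft1979Flux, §5 (5.1)–(5.4)] -/
theorem projSlabDefect_succ_le (hρ : Continuous ρ) (hρu : ∀ g, ρ g ∈ Matrix.unitaryGroup (Fin N) ℂ)
    {β : ℝ} (hβ : 0 ≤ β) {z : G} (hz : z ∈ Subgroup.center G) {n : ℕ} (hn : 0 < n) (hzn : z ^ n = 1) (ℓ L : ℕ)
    {t : ℕ} (ht : 2 ≤ t) :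
    projSlabDefect ρ β z n ℓ L (t + 1) ≤ projSlabDefect ρ β z n ℓ L t := by
  obtain ⟨m, rfl⟩ : ∃ m, n = m + 1 := ⟨n - 1, by omega⟩
  obtain ⟨s, ν, hν, hZ⟩ := exists_powSum_projSlabZ hρ hρu hβ hz hzn ℓ L
  exact SpectralPurity.defect_succ_le (Z := fun t => projSlabZ ρ β z (m + 1) ℓ L t) (t₀ := 2) hν hZ ht
    (projSlabZ_pos ρ hρ β z (Nat.succ_pos m) ℓ L t) (projSlabZ_pos ρ hρ β z (Nat.succ_pos m) ℓ L (t + 1))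

/-- ★★ **THE PROJECTED TWISTED PURITY DEFECT IS NON-INCREASING IN EUCLIDEAN TIME** (`t ≥ 2`): `2 ≤ t ≤ t' ⇒
projSlabDefect ρ β z n ℓ L t' ≤ projSlabDefect ρ β z n ℓ L t` — for EVERY compact `G`, continuous unitary `ρ`, `β ≥ 0`, central `z` with
`z ^ n = 1`, and every box.  The purity `Tr ϱ_t²` of the normalised e₂-projected thermal state `ϱ_t ∝ P(e₂=0)𝕋^t` increases with `t`.
[cite: tHooft1979Flux, §5 (5.1)–(5.4)] -/
theorem projSlabDefect_antitone (hρ : Continuous ρ) (hρu : ∀ g, ρ g ∈ Matrix.unitaryGroup (Fin N) ℂ)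
    {β : ℝ} (hβ : 0 ≤ β) {z : G} (hz : z ∈ Subgroup.center G) {n : ℕ} (hn : 0 < n) (hzn : z ^ n = 1) (ℓ L : ℕ)
    {t t' : ℕ} (ht : 2 ≤ t) (htt' : t ≤ t') :
    projSlabDefect ρ β z n ℓ L t' ≤ projSlabDefect ρ β z n ℓ L t := by
  induction t', htt' using Nat.le_induction with
  | base => exact le_rfl
  | succ t' ht' ih => exact (projSlabDefect_succ_le hρ hρu hβ hz hn hzn ℓ L (ht.trans ht')).trans ih

/-- ★ **THRESHOLD-FREE ONE-TIME LEVER**: a bound `projSlabDefect(t*) ≤ δ` at ONE time `t* ≥ 2` holds at every later time (any real `δ`;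
compare K35 `projSlabDefect_le_two_mul_pow_of_le`, which needs `δ < 1∕2` but returns a rate). [cite: tHooft1979Flux, §5 (5.1)–(5.4)] -/
theorem projSlabDefect_le_of_le_at (hρ : Continuous ρ) (hρu : ∀ g, ρ g ∈ Matrix.unitaryGroup (Fin N) ℂ)
    {β : ℝ} (hβ : 0 ≤ β) {z : G} (hz : z ∈ Subgroup.center G) {n : ℕ} (hn : 0 < n) (hzn : z ^ n = 1) (ℓ L : ℕ)
    {ts : ℕ} (hts : 2 ≤ ts) {δ : ℝ} (hD : projSlabDefect ρ β z n ℓ L ts ≤ δ) {t : ℕ} (ht : ts ≤ t) :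
    projSlabDefect ρ β z n ℓ L t ≤ δ :=
  (projSlabDefect_antitone hρ hρu hβ hz hn hzn ℓ L hts ht).trans hD

/-- `projSlabZ(2t) ≤ projSlabZ(t)²` for `t ≥ 2` (the period-doubled trace is at most the square). [cite: tHooft1979Flux, §5 (5.1)–(5.4)] -/
theorem projSlabZ_two_mul_le_sq (hρ : Continuous ρ) (hρu : ∀ g, ρ g ∈ Matrix.unitaryGroup (Fin N) ℂ)
    {β : ℝ} (hβ : 0 ≤ β) {z : G} (hz : z ∈ Subgroup.center G) {n : ℕ} (hn : 0 < n) (hzn : z ^ n = 1) (ℓ L : ℕ)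
    {t : ℕ} (ht : 2 ≤ t) :
    projSlabZ ρ β z n ℓ L (2 * t) ≤ projSlabZ ρ β z n ℓ L t ^ 2 := by
  obtain ⟨m, rfl⟩ : ∃ m, n = m + 1 := ⟨n - 1, by omega⟩
  obtain ⟨s, ν, hν, hZ⟩ := exists_powSum_projSlabZ hρ hρu hβ hz hzn ℓ L
  exact SpectralPurity.powSum_two_mul_le_sq (Z := fun t => projSlabZ ρ β z (m + 1) ℓ L t) (t₀ := 2) hν hZ ht

/-- The defect is non-negative for `t ≥ 2`. [cite: tHooft1979Flux, §5 (5.1)–(5.4)] -/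
theorem projSlabDefect_nonneg' (hρ : Continuous ρ) (hρu : ∀ g, ρ g ∈ Matrix.unitaryGroup (Fin N) ℂ)
    {β : ℝ} (hβ : 0 ≤ β) {z : G} (hz : z ∈ Subgroup.center G) {n : ℕ} (hn : 0 < n) (hzn : z ^ n = 1) (ℓ L : ℕ)
    {t : ℕ} (ht : 2 ≤ t) :
    0 ≤ projSlabDefect ρ β z n ℓ L t := by
  have h := projSlabZ_two_mul_le_sq hρ hρu hβ hz hn hzn ℓ L ht
  have hpos : 0 < projSlabZ ρ β z n ℓ L t := projSlabZ_pos ρ hρ β z hn ℓ L t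
  unfold projSlabDefect
  rw [sub_nonneg, div_le_one (by positivity)]
  exact h

end Lattice

/-! ## §3 The long direction: the e-projected transfer matrix ALONG the tube -/

section Long

variable {G : Type*} [Group G] [TopologicalSpace G] [IsTopologicalGroup G] [CompactSpace G]
  [MeasurableSpace G] [BorelSpace G] [SecondCountableTopology G] {N : ℕ} {ρ : G →* Matrix (Fin N) (Fin N) ℂ}

/-- ★ **Spectral representation in the LONG direction**: for `β ≥ 0`, continuous unitary `ρ`, central `z` with `z ^ (m+1) = 1`, every
transverse size `ℓ` and EVERY time period `t` there is a family `μ_j ≥ 0`, `Σ μ_j² < ∞`, with `projSlabZ ρ β z (m+1) ℓ (M+2) t = Σ_j μ_j^{M+2}`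
for every `M` — the eigenvalues WITH multiplicity of 't Hooft's e-flux-projected transfer matrix along direction `2` (slice: the magnetically
twisted `ℓ × ℓ` torus × the time circle of period `t`).  Proof: g2's exchange identity `projSlabZ_swap` (`L ↔ t`, `z ↦ z⁻¹`) and K35 at `z⁻¹`.
[cite: tHooft1979Flux, §5 (5.1)–(5.4) and §6 (6.2)] -/
theorem exists_spectralData_projSlabZ_long (hρ : Continuous ρ) (hρu : ∀ g, ρ g ∈ Matrix.unitaryGroup (Fin N) ℂ)
    {β : ℝ} (hβ : 0 ≤ β) {z : G} (hz : z ∈ Subgroup.center G) {m : ℕ} (hzn : z ^ (m + 1) = 1) (ℓ t : ℕ) :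
    ∃ (s : Set (MeasureTheory.Lp ℝ 2 (MeasureTheory.Measure.pi fun _ : FinSpatialSite ℓ ℓ t × Fin 3 => haarProbability G)))
      (μ : s → ℝ), (∀ j, 0 ≤ μ j) ∧ Summable (fun j => μ j ^ 2) ∧
      ∀ M : ℕ, HasSum (fun j => μ j ^ (M + 2)) (projSlabZ ρ β z (m + 1) ℓ (M + 2) t) := by
  have hz' : z⁻¹ ∈ Subgroup.center G := Subgroup.inv_mem _ hz
  have hzn' : z⁻¹ ^ (m + 1) = 1 := by rw [inv_pow, hzn, inv_one]
  obtain ⟨s, μ, hμ, hsq, hsum⟩ := exists_spectralData_projSlabZ hρ hρu hβ hz' hzn' ℓ t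
  refine ⟨s, μ, hμ, hsq, fun M => ?_⟩
  rw [projSlabZ_swap ρ hρ β z (m + 1) ℓ (M + 2) t]
  exact hsum M

/-- The long-direction power sums in the currency of §1 (`t₀ = 2` in the LENGTH variable). [cite: tHooft1979Flux, §6 (6.2)] -/
theorem exists_powSum_projSlabZ_long (hρ : Continuous ρ) (hρu : ∀ g, ρ g ∈ Matrix.unitaryGroup (Fin N) ℂ)
    {β : ℝ} (hβ : 0 ≤ β) {z : G} (hz : z ∈ Subgroup.center G) {m : ℕ} (hzn : z ^ (m + 1) = 1) (ℓ t : ℕ) :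
    ∃ (s : Set (MeasureTheory.Lp ℝ 2 (MeasureTheory.Measure.pi fun _ : FinSpatialSite ℓ ℓ t × Fin 3 => haarProbability G)))
      (μ : s → ℝ), (∀ j, 0 ≤ μ j) ∧ ∀ L, 2 ≤ L → HasSum (fun j => μ j ^ L) (projSlabZ ρ β z (m + 1) ℓ L t) := by
  obtain ⟨s, μ, hμ, -, hsum⟩ := exists_spectralData_projSlabZ_long hρ hρu hβ hz hzn ℓ t
  refine ⟨s, μ, hμ, fun L hL => ?_⟩
  obtain ⟨M, rfl⟩ : ∃ M, L = M + 2 := ⟨L - 2, by omega⟩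
  exact hsum M

/-- **Doubling sub-multiplicativity in the LENGTH**: `projSlabZ(β; ℓ, 2L, t) ≤ projSlabZ(β; ℓ, L, t)²` for `L ≥ 2`, every `t`
(`Tr 𝕊^{2L} ≤ (Tr 𝕊^L)²` for the positive transfer matrix along the tube). [cite: tHooft1979Flux, §6 (6.2)] -/
theorem projSlabZ_two_mul_long_le_sq (hρ : Continuous ρ) (hρu : ∀ g, ρ g ∈ Matrix.unitaryGroup (Fin N) ℂ)
    {β : ℝ} (hβ : 0 ≤ β) {z : G} (hz : z ∈ Subgroup.center G) {n : ℕ} (hn : 0 < n) (hzn : z ^ n = 1) (ℓ t : ℕ)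
    {L : ℕ} (hL : 2 ≤ L) :
    projSlabZ ρ β z n ℓ (2 * L) t ≤ projSlabZ ρ β z n ℓ L t ^ 2 := by
  obtain ⟨m, rfl⟩ : ∃ m, n = m + 1 := ⟨n - 1, by omega⟩
  obtain ⟨s, μ, hμ, hZ⟩ := exists_powSum_projSlabZ_long hρ hρu hβ hz hzn ℓ t
  exact SpectralPurity.powSum_two_mul_le_sq (Z := fun L => projSlabZ ρ β z (m + 1) ℓ L t) (t₀ := 2) hμ hZ hL

/-- ★ **The LENGTH-doubling defect is non-increasing in the length**: for `2 ≤ L ≤ L'` and every time period `t`,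
`1 − projSlabZ(2L')∕projSlabZ(L')² ≤ 1 − projSlabZ(2L)∕projSlabZ(L)²` (by g2's `projSlabDefect_eq_lengthDoubling` this is the time-monotonicity
of §2 for the `z⁻¹`-twisted tube read along the other axis; proved here directly from the long-direction power sums). [cite: tHooft1979Flux, §6 (6.2)] -/
theorem lengthDefect_antitone (hρ : Continuous ρ) (hρu : ∀ g, ρ g ∈ Matrix.unitaryGroup (Fin N) ℂ)
    {β : ℝ} (hβ : 0 ≤ β) {z : G} (hz : z ∈ Subgroup.center G) {n : ℕ} (hn : 0 < n) (hzn : z ^ n = 1) (ℓ t : ℕ)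
    {L L' : ℕ} (hL : 2 ≤ L) (hLL' : L ≤ L') :
    1 - projSlabZ ρ β z n ℓ (2 * L') t / projSlabZ ρ β z n ℓ L' t ^ 2 ≤
      1 - projSlabZ ρ β z n ℓ (2 * L) t / projSlabZ ρ β z n ℓ L t ^ 2 := by
  obtain ⟨m, rfl⟩ : ∃ m, n = m + 1 := ⟨n - 1, by omega⟩
  obtain ⟨s, μ, hμ, hZ⟩ := exists_powSum_projSlabZ_long hρ hρu hβ hz hzn ℓ t
  induction L', hLL' using Nat.le_induction with
  | base => exact le_rfl
  | succ L' hL' ih =>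
    refine le_trans ?_ ih
    exact SpectralPurity.defect_succ_le (Z := fun L => projSlabZ ρ β z (m + 1) ℓ L t) (t₀ := 2) hμ hZ (hL.trans hL')
      (projSlabZ_pos ρ hρ β z (Nat.succ_pos m) ℓ L' t) (projSlabZ_pos ρ hρ β z (Nat.succ_pos m) ℓ (L' + 1) t)

end Long

end Summit.QuantumFields.YangMills.Cruxes.IRcof.TwistedSlab

end
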